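import Summits.AtomisticToContinuum.Crystallization.Theorems.OverbindingBudgetAffineFarFieldCellSandwich
import Summits.AtomisticToContinuum.Crystallization.Theorems.OverbindingBudgetAffineFarFieldCellTRDCubic

/-!
# OverbindingBudget (2c) — part 27Vb-V(A): the far-field cell SUM (lens-4 g96; r1673 S3, r1693 (B)(iv))

Support file, pure analysis on `ℝ³ = EuclideanSpace ℝ (Fin 3)`, no atlas.  This is the bookkeeping layer of
scheme B («27V-TWICE», DESK27V-g94 §1): the per-cell quadrature rule of parts 27Va-B / 27Vb-V(B1) summed over
a finite family of cells, and the window identity that turns «actual far region minus reference far region»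
into the 27V-I INTERFACE integral.  Contents:

* `integral_biUnion_finset₀` — the integral over a finite union of measurable, pairwise A.E.-DISJOINT sets
  is the sum of the integrals (Mathlib's `integral_biUnion_finset` wants honest disjointness; Voronoi cells
  share facets); `aedisjoint_biUnion_finset` (two finite unions of pairwise a.e.-disjoint families);
* transport under the cell maps: `volume_image_affMap` (all sets, via the Haar scaling of `x ↦ q + A(x − p)`),
  `aedisjoint_image_affMap`, `ae_eq_image_affMap`, `moveMap_eq_affMap` and the `moveMap` corollaries — so
  a.e.-tilings are moved / distorted cell by cell;
* ★ `abs_sum_weighted_sub_le` — the ACTUAL-side far sum: with weights `w_i = 1/|K_i|`,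
  `|Σ_i (w_i ∫_{K_i} g − (g(p_i) + (σ/2)Δg(p_i)))| ≤ Σ_i (η_i D₁ᵢ + (δ_i/2) D₂ᵢ + (τ_i/6) D₃ᵢ + (μ₄ᵢ/24) D₄ᵢ)`
  for loose moment cells `K_i` about `p_i` with ONE nominal `σ` (no disjointness needed);
* ★ `abs_integral_biUnion_sub_sum_le` — the same over an a.e.-disjoint family in UNION form
  `|∫_{⋃K_i} g − Σ_i |K_i|(g(p_i) + (σ/2)Δg(p_i))| ≤ Σ_i |K_i|(…)` (the reference side: `|K_i| = 1/ρ`);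
* ★ `integral_far_eq_window_sub_core`, `far_sub_far_eq_core_sub_core` — if far cells and core cells tile a
  window `W` a.e. then `∫_{U_far} g = ∫_W g − ∫_{U_core} g`, hence
  `∫_{U_far^act} g − ∫_{U_far^ref} g = ∫_{U_core^ref} g − ∫_{U_core^act} g` (both tessellations tile the same
  `W ⊇ supp g`): the DENSITY + INTERFACE split of the desk, the reference main term never evaluated;
* named reference cells: `isLooseMomentCell_kCell` / `cubic_clause_kCell` (moved ideal `k`-cell, `η = 0`,
  `τ = 0`) and `isLooseMomentCell_hCell` / `cubic_clause_hCell` (moved ideal `h`-cell, `τ = 7ν³/(360√2)`),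
  from parts 27Vb-K (`isMomentCell_rdCell_nu`, `isMomentCell_trdCell_nu`, `cubic_clause_trdCell_nu`) under
  the same two named shape leaves `hC` (27Vb-K2) and `hT` (27Vb-K3).
-/

namespace Summit.AtomisticToContinuum.Crystallization.Theorems.OverbindingBudgetAffineFarFieldCellSum

noncomputable section

open Set Filter MeasureTheory
open scoped Topology
open Summit.AtomisticToContinuum.Crystallization.Theorems.OverbindingBudgetAffineFarFieldTaylor
open Summit.AtomisticToContinuum.Crystallization.Theorems.OverbindingBudgetAffineFarFieldCellTaylor
open Summit.AtomisticToContinuum.Crystallization.Theorems.OverbindingBudgetAffineFarFieldCellSymm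
open Summit.AtomisticToContinuum.Crystallization.Theorems.OverbindingBudgetAffineFarFieldCellMove
open Summit.AtomisticToContinuum.Crystallization.Theorems.OverbindingBudgetAffineFarFieldCellAffine
open Summit.AtomisticToContinuum.Crystallization.Theorems.OverbindingBudgetAffineFarFieldCellLoose
open Summit.AtomisticToContinuum.Crystallization.Theorems.OverbindingBudgetAffineFarFieldCellSandwich
open Summit.AtomisticToContinuum.Crystallization.Theorems.OverbindingBudgetAffineFarFieldCellRD
open Summit.AtomisticToContinuum.Crystallization.Theorems.OverbindingBudgetAffineFarFieldCellTwist
open Summit.AtomisticToContinuum.Crystallization.Theorems.OverbindingBudgetAffineFarFieldCellTRD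
open Summit.AtomisticToContinuum.Crystallization.Theorems.OverbindingBudgetAffineFarFieldCellTRDCubic

local notation "E3" => EuclideanSpace ℝ (Fin 3)

/-! ### Finite a.e.-disjoint unions -/

/-- Integral over a finite union of measurable, pairwise a.e.-disjoint sets `=` the sum of the integrals. -/
theorem integral_biUnion_finset₀ {ι : Type*} (t : Finset ι) {s : ι → Set E3}
    {F : Type*} [NormedAddCommGroup F] [NormedSpace ℝ F] {g : E3 → F}
    (hs : ∀ i ∈ t, MeasurableSet (s i))
    (h's : (↑t : Set ι).Pairwise fun i j => AEDisjoint volume (s i) (s j))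
    (hf : ∀ i ∈ t, IntegrableOn g (s i)) :
    ∫ x in ⋃ i ∈ t, s i, g x = ∑ i ∈ t, ∫ x in s i, g x := by
  classical
  induction t using Finset.induction_on with
  | empty => simp
  | insert a t hat IH =>
    simp only [Finset.coe_insert, Finset.forall_mem_insert, Set.pairwise_insert, Finset.mem_coe,
      Finset.set_biUnion_insert] at hs hf h's ⊢
    rw [setIntegral_union₀ _ _ hf.1 (integrableOn_finset_iUnion.2 hf.2)]
    · rw [Finset.sum_insert hat, IH hs.2 h's.1 hf.2]
    · change volume (s a ∩ ⋃ i ∈ t, s i) = 0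
      rw [Set.inter_iUnion₂]
      exact (measure_biUnion_null_iff t.countable_toSet).2
        fun i hi => (h's.2 i hi (ne_of_mem_of_not_mem hi hat).symm).1
    · exact (Finset.measurableSet_biUnion _ hs.2).nullMeasurableSet

/-- Two finite unions of cells are a.e.-disjoint as soon as the cells are pairwise a.e.-disjoint. -/
theorem aedisjoint_biUnion_finset {ι κ : Type*} (t : Finset ι) (u : Finset κ) {K : ι → Set E3}
    {C : κ → Set E3} (h : ∀ i ∈ t, ∀ j ∈ u, AEDisjoint volume (K i) (C j)) :
    AEDisjoint volume (⋃ i ∈ t, K i) (⋃ j ∈ u, C j) := by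
  change volume ((⋃ i ∈ t, K i) ∩ ⋃ j ∈ u, C j) = 0
  rw [Set.iUnion₂_inter]
  refine (measure_biUnion_null_iff t.countable_toSet).2 fun i hi => ?_
  rw [Set.inter_iUnion₂]
  exact (measure_biUnion_null_iff u.countable_toSet).2 fun j hj => h i hi j hj

/-! ### Transport of a.e.-tilings under the cell maps -/

/-- `affMap p q A = (q + ·) ∘ A ∘ (−p + ·)`. -/
theorem affMap_eq_comp (p q : E3) (A : E3 ≃L[ℝ] E3) :
    affMap p q A = (fun x => q + x) ∘ (⇑A) ∘ (fun x => -p + x) := by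
  funext x; simp [affMap, neg_add_eq_sub]

/-- Haar scaling of the cell map on ALL sets: `|affMap '' S| = |det A|·|S|`. -/
theorem volume_image_affMap (p q : E3) (A : E3 ≃L[ℝ] E3) (S : Set E3) :
    volume (affMap p q A '' S) = ENNReal.ofReal |LinearMap.det (A : E3 →ₗ[ℝ] E3)| * volume S := by
  rw [affMap_eq_comp, Set.image_comp, Set.image_comp, Set.image_add_left, measure_preimage_add,
    Measure.addHaar_image_continuousLinearEquiv, Set.image_add_left, measure_preimage_add]

/-- The cell map sends null sets to null sets. -/
theorem volume_image_affMap_null (p q : E3) (A : E3 ≃L[ℝ] E3) {S : Set E3} (hS : volume S = 0) :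
    volume (affMap p q A '' S) = 0 := by
  rw [volume_image_affMap, hS, mul_zero]

/-- A.e.-disjointness is transported by the cell map. -/
theorem aedisjoint_image_affMap (p q : E3) (A : E3 ≃L[ℝ] E3) {K₁ K₂ : Set E3}
    (h : AEDisjoint volume K₁ K₂) : AEDisjoint volume (affMap p q A '' K₁) (affMap p q A '' K₂) := by
  change volume (affMap p q A '' K₁ ∩ affMap p q A '' K₂) = 0
  rw [← Set.image_inter (injective_affMap p q A)]
  exact volume_image_affMap_null p q A h

/-- A.e.-equality of sets is transported by the cell map. -/
theorem ae_eq_image_affMap (p q : E3) (A : E3 ≃L[ℝ] E3) {S T : Set E3} (h : S =ᵐ[volume] T) :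
    affMap p q A '' S =ᵐ[volume] affMap p q A '' T := by
  rw [ae_eq_set] at h ⊢
  rw [← Set.image_sdiff (injective_affMap p q A), ← Set.image_sdiff (injective_affMap p q A)]
  exact ⟨volume_image_affMap_null p q A h.1, volume_image_affMap_null p q A h.2⟩

/-- The cell map commutes with finite unions of cells. -/
theorem image_affMap_biUnion {ι : Type*} (t : Finset ι) (p q : E3) (A : E3 ≃L[ℝ] E3) (K : ι → Set E3) :
    affMap p q A '' (⋃ i ∈ t, K i) = ⋃ i ∈ t, affMap p q A '' K i := Set.image_iUnion₂ _ _

/-- The lattice-isometry move is the cell map of the isometry. -/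
theorem moveMap_eq_affMap (p q : E3) (R : E3 ≃ₗᵢ[ℝ] E3) :
    moveMap p q R = affMap p q R.toContinuousLinearEquiv := by
  funext x; simp [moveMap, affMap]

/-- A.e.-disjointness is transported by lattice-isometry moves. -/
theorem aedisjoint_image_moveMap (p q : E3) (R : E3 ≃ₗᵢ[ℝ] E3) {K₁ K₂ : Set E3}
    (h : AEDisjoint volume K₁ K₂) : AEDisjoint volume (moveMap p q R '' K₁) (moveMap p q R '' K₂) := by
  rw [moveMap_eq_affMap]; exact aedisjoint_image_affMap p q _ h

/-- A.e.-equality of sets is transported by lattice-isometry moves. -/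
theorem ae_eq_image_moveMap (p q : E3) (R : E3 ≃ₗᵢ[ℝ] E3) {S T : Set E3} (h : S =ᵐ[volume] T) :
    moveMap p q R '' S =ᵐ[volume] moveMap p q R '' T := by
  rw [moveMap_eq_affMap]; exact ae_eq_image_affMap p q _ h

/-! ### The summed quadrature rule -/

/-- ★ ACTUAL SIDE (weights `w_i = 1/|K_i|`, cells need not be disjoint): the far sum of
`w_i ∫_{K_i} g − (g(p_i) + (σ/2)Δg(p_i))` over loose moment cells `K_i` about `p_i` with one nominal `σ`. -/
theorem abs_sum_weighted_sub_le {ι : Type*} (t : Finset ι) {K : ι → Set E3} {U : Set E3} {p : ι → E3}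
    {σ : ℝ} {η δ μ₃ μ₄ τ D₁ D₂ D₃ D₄ : ι → ℝ}
    (hK : ∀ i ∈ t, IsLooseMomentCell (K i) (p i) (η i) σ (δ i) (μ₃ i) (μ₄ i))
    (hτ0 : ∀ i ∈ t, 0 ≤ τ i)
    (hτ : ∀ i ∈ t, ∀ B : E3 [×3]→L[ℝ] ℝ,
      |∫ x in K i, B (fun _ => x - p i)| ≤ τ i * (volume (K i)).toReal * ‖B‖)
    (hvol : ∀ i ∈ t, 0 < (volume (K i)).toReal)
    (hU : IsOpen U) (hKU : ∀ i ∈ t, K i ⊆ U) {g : E3 → ℝ} (hg : ContDiffOn ℝ 4 g U)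
    (h1 : ∀ i ∈ t, ‖fderiv ℝ g (p i)‖ ≤ D₁ i) (h2 : ∀ i ∈ t, ‖iteratedFDeriv ℝ 2 g (p i)‖ ≤ D₂ i)
    (h3 : ∀ i ∈ t, ‖iteratedFDeriv ℝ 3 g (p i)‖ ≤ D₃ i)
    (h4 : ∀ i ∈ t, ∀ x ∈ K i, ‖iteratedFDeriv ℝ 4 g x‖ ≤ D₄ i) :
    |∑ i ∈ t, ((volume (K i)).toReal⁻¹ * (∫ x in K i, g x) - (g (p i) + σ / 2 * lap g (p i)))|
      ≤ ∑ i ∈ t, (η i * D₁ i + δ i / 2 * D₂ i + τ i / 6 * D₃ i + μ₄ i / 24 * D₄ i) := by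
  refine (Finset.abs_sum_le_sum_abs _ _).trans (Finset.sum_le_sum fun i hi => ?_)
  have h := cell_taylor_loose_tau (hK i hi) (hτ0 i hi) (hτ i hi) hU (hKU i hi) hg (h1 i hi) (h2 i hi)
    (h3 i hi) (h4 i hi)
  have hv := hvol i hi
  have e : (volume (K i)).toReal⁻¹ * (∫ x in K i, g x) - (g (p i) + σ / 2 * lap g (p i))
      = (volume (K i)).toReal⁻¹
        * ((∫ x in K i, g x) - (volume (K i)).toReal * (g (p i) + σ / 2 * lap g (p i))) := by
    field_simp
  rw [e, abs_mul, abs_inv, abs_of_pos hv, inv_mul_le_iff₀ hv]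
  exact h

/-- ★ UNION FORM (an a.e.-disjoint finite family of measurable loose moment cells, e.g. the reference
tessellation with `|K_i| = 1/ρ`): `|∫_{⋃K_i} g − Σ_i |K_i|(g(p_i) + (σ/2)Δg(p_i))| ≤ Σ_i |K_i|(…)`. -/
theorem abs_integral_biUnion_sub_sum_le {ι : Type*} (t : Finset ι) {K : ι → Set E3} {U : Set E3}
    {p : ι → E3} {σ : ℝ} {η δ μ₃ μ₄ τ D₁ D₂ D₃ D₄ : ι → ℝ}
    (hK : ∀ i ∈ t, IsLooseMomentCell (K i) (p i) (η i) σ (δ i) (μ₃ i) (μ₄ i))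
    (hd : (↑t : Set ι).Pairwise fun i j => AEDisjoint volume (K i) (K j))
    (hτ0 : ∀ i ∈ t, 0 ≤ τ i)
    (hτ : ∀ i ∈ t, ∀ B : E3 [×3]→L[ℝ] ℝ,
      |∫ x in K i, B (fun _ => x - p i)| ≤ τ i * (volume (K i)).toReal * ‖B‖)
    (hU : IsOpen U) (hKU : ∀ i ∈ t, K i ⊆ U) {g : E3 → ℝ} (hg : ContDiffOn ℝ 4 g U)
    (h1 : ∀ i ∈ t, ‖fderiv ℝ g (p i)‖ ≤ D₁ i) (h2 : ∀ i ∈ t, ‖iteratedFDeriv ℝ 2 g (p i)‖ ≤ D₂ i)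
    (h3 : ∀ i ∈ t, ‖iteratedFDeriv ℝ 3 g (p i)‖ ≤ D₃ i)
    (h4 : ∀ i ∈ t, ∀ x ∈ K i, ‖iteratedFDeriv ℝ 4 g x‖ ≤ D₄ i) :
    |(∫ x in ⋃ i ∈ t, K i, g x)
        - ∑ i ∈ t, (volume (K i)).toReal * (g (p i) + σ / 2 * lap g (p i))|
      ≤ ∑ i ∈ t, (volume (K i)).toReal
          * (η i * D₁ i + δ i / 2 * D₂ i + τ i / 6 * D₃ i + μ₄ i / 24 * D₄ i) := by
  have hs : ∀ i ∈ t, MeasurableSet (K i) := fun i hi => (hK i hi).isCompact.measurableSet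
  have hf : ∀ i ∈ t, IntegrableOn g (K i) := fun i hi =>
    (hg.continuousOn.mono (hKU i hi)).integrableOn_compact (hK i hi).isCompact
  rw [integral_biUnion_finset₀ t hs hd hf, ← Finset.sum_sub_distrib]
  refine (Finset.abs_sum_le_sum_abs _ _).trans (Finset.sum_le_sum fun i hi => ?_)
  exact cell_taylor_loose_tau (hK i hi) (hτ0 i hi) (hτ i hi) hU (hKU i hi) hg (h1 i hi) (h2 i hi)
    (h3 i hi) (h4 i hi)

/-! ### The window identity (DENSITY + INTERFACE split) -/

/-- If the far region and the core region are a.e.-disjoint and tile the window `W` a.e., then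
`∫_{U_far} g = ∫_W g − ∫_{U_core} g`. -/
theorem integral_far_eq_window_sub_core {W Ufar Ucore : Set E3}
    {F : Type*} [NormedAddCommGroup F] [NormedSpace ℝ F] {g : E3 → F}
    (hdisj : AEDisjoint volume Ufar Ucore) (hcore : NullMeasurableSet Ucore volume)
    (hcover : (Ufar ∪ Ucore : Set E3) =ᵐ[volume] W) (hfi : IntegrableOn g Ufar) (hci : IntegrableOn g Ucore) :
    ∫ x in Ufar, g x = (∫ x in W, g x) - ∫ x in Ucore, g x := by
  rw [← setIntegral_congr_set hcover, setIntegral_union₀ hdisj hcore hfi hci, add_sub_cancel_right]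

/-- ★ Two tessellations (actual / reference) of the SAME window: the difference of the far integrals is the
difference of the CORE integrals with the opposite sign — the 27V-I interface integral
`∫ g (1_{U_core^ref} − 1_{U_core^act})`; the common main term `∫_W g` never appears. -/
theorem far_sub_far_eq_core_sub_core {W Uf₁ Uc₁ Uf₂ Uc₂ : Set E3}
    {F : Type*} [NormedAddCommGroup F] [NormedSpace ℝ F] {g : E3 → F}
    (hd₁ : AEDisjoint volume Uf₁ Uc₁) (hc₁ : NullMeasurableSet Uc₁ volume)
    (hcov₁ : (Uf₁ ∪ Uc₁ : Set E3) =ᵐ[volume] W) (hf₁ : IntegrableOn g Uf₁) (hci₁ : IntegrableOn g Uc₁)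
    (hd₂ : AEDisjoint volume Uf₂ Uc₂) (hc₂ : NullMeasurableSet Uc₂ volume)
    (hcov₂ : (Uf₂ ∪ Uc₂ : Set E3) =ᵐ[volume] W) (hf₂ : IntegrableOn g Uf₂) (hci₂ : IntegrableOn g Uc₂) :
    (∫ x in Uf₁, g x) - ∫ x in Uf₂, g x = (∫ x in Uc₂, g x) - ∫ x in Uc₁, g x := by
  rw [integral_far_eq_window_sub_core hd₁ hc₁ hcov₁ hf₁ hci₁,
    integral_far_eq_window_sub_core hd₂ hc₂ hcov₂ hf₂ hci₂]
  abel

/-- If `g` vanishes off the window then `∫_W g = ∫ g`: the window may be taken to be the kernel's support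
(any `W ⊇ supp g`), so both tessellations see the same main term. -/
theorem integral_window_eq_integral {W : Set E3} {F : Type*} [NormedAddCommGroup F] [NormedSpace ℝ F]
    {g : E3 → F} (hg : ∀ x ∉ W, g x = 0) :
    ∫ x in W, g x = ∫ x, g x :=
  setIntegral_eq_integral_of_forall_compl_eq_zero fun x hx => hg x hx

/-! ### Named reference cells: moved ideal `k`- and `h`-cells -/

/-- The REFERENCE `k`-cell at nearest-neighbour distance `ν`, moved to the site `q` by the lattice isometry
`R`, is a loose moment cell with `η = 0`, `σ = ν²/16`, `δ = 0`, `μ₃ = 3(ν/(2√2))³`, `μ₄ = (41/960)ν⁴`. -/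
theorem isLooseMomentCell_kCell (hC : HasRadialMoments (rdCell 1) 16 24 (656 / 15)) {ν : ℝ} (hν : 0 < ν)
    (q : E3) (R : E3 ≃ₗᵢ[ℝ] E3) :
    IsLooseMomentCell (moveMap 0 q R '' rdCell (ν / (2 * Real.sqrt 2))) q 0 (ν ^ 2 / 16) 0
      (3 * (ν / (2 * Real.sqrt 2)) ^ 3) (41 / 960 * ν ^ 4) :=
  IsMomentCell.loose (IsMomentCell.image_moveMap (isMomentCell_rdCell_nu hC hν) q R)

/-- The moved `k`-cell is centrally symmetric about its site, so its cubic clause holds with `τ = 0`. -/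
theorem cubic_clause_kCell (h : ℝ) (q : E3) (R : E3 ≃ₗᵢ[ℝ] E3) (B : E3 [×3]→L[ℝ] ℝ) :
    |∫ x in moveMap 0 q R '' rdCell h, B (fun _ => x - q)|
      ≤ 0 * (volume (moveMap 0 q R '' rdCell h)).toReal * ‖B‖ :=
  cubic_clause_of_centrallySymmetric
    (IsCentrallySymmetric.image_moveMap (isCentrallySymmetric_rdCell h) q R) B

/-- Volume of the moved `k`-cell: `ν³/√2`. -/
theorem volume_kCell (hC : HasRadialMoments (rdCell 1) 16 24 (656 / 15)) {ν : ℝ} (hν : 0 < ν)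
    (q : E3) (R : E3 ≃ₗᵢ[ℝ] E3) :
    (volume (moveMap 0 q R '' rdCell (ν / (2 * Real.sqrt 2)))).toReal = ν ^ 3 / Real.sqrt 2 := by
  rw [volume_image_moveMap, volume_rdCell_nu hC hν]

/-- The REFERENCE `h`-cell at nearest-neighbour distance `ν`, moved to `q` by `R`: the same loose data. -/
theorem isLooseMomentCell_hCell (hC : HasRadialMoments (rdCell 1) 16 24 (656 / 15)) {ν : ℝ} (hν : 0 < ν)
    (q : E3) (R : E3 ≃ₗᵢ[ℝ] E3) :
    IsLooseMomentCell (moveMap 0 q R '' trdCell (ν / (2 * Real.sqrt 2))) q 0 (ν ^ 2 / 16) 0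
      (3 * (ν / (2 * Real.sqrt 2)) ^ 3) (41 / 960 * ν ^ 4) :=
  IsMomentCell.loose (IsMomentCell.image_moveMap (isMomentCell_trdCell_nu hC hν) q R)

/-- The moved `h`-cell satisfies the structured cubic clause with `τ = 7ν³/(360√2)` (part 27Vb-K3w). -/
theorem cubic_clause_hCell (hC : HasRadialMoments (rdCell 1) 16 24 (656 / 15))
    (hT : |∫ x in trdCell 1, x 0 * x 1 * x 2| ≤ 112 / 405) {ν : ℝ} (hν : 0 < ν)
    (q : E3) (R : E3 ≃ₗᵢ[ℝ] E3) (B : E3 [×3]→L[ℝ] ℝ) :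
    |∫ x in moveMap 0 q R '' trdCell (ν / (2 * Real.sqrt 2)), B (fun _ => x - q)|
      ≤ 7 * ν ^ 3 / (360 * Real.sqrt 2)
        * (volume (moveMap 0 q R '' trdCell (ν / (2 * Real.sqrt 2)))).toReal * ‖B‖ := by
  rw [← cubic_tau_nu ν]
  have hτ0 : 0 ≤ 14 / 45 * (ν / (2 * Real.sqrt 2)) ^ 3 := by positivity
  exact cubic_clause_image_moveMap (cubic_clause_trdCell_nu hC hT hν) hτ0 q R B

/-- Volume of the moved `h`-cell: `ν³/√2`. -/
theorem volume_hCell (hC : HasRadialMoments (rdCell 1) 16 24 (656 / 15)) {ν : ℝ} (hν : 0 < ν)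
    (q : E3) (R : E3 ≃ₗᵢ[ℝ] E3) :
    (volume (moveMap 0 q R '' trdCell (ν / (2 * Real.sqrt 2)))).toReal = ν ^ 3 / Real.sqrt 2 := by
  rw [volume_image_moveMap, volume_trdCell_nu hC hν]

end

end Summit.AtomisticToContinuum.Crystallization.Theorems.OverbindingBudgetAffineFarFieldCellSum
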